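import Summits.Ventures.HodgeRepro2.T5FinitePlaceLocalDegree
import Summits.Ventures.HodgeRepro2.T5FinitePlaceUnramifiedResidue

/-!
# `v` splits in the CM field `K` ⟺ `θ` is a `v`-adic square; the local-degree formula at every finite place;
the global count `#{w ∣ v} · [K_w : K⁺_v] = 2` (cell pub-hodge-repro2, seat p3)

Tier-5 N2 support, §N2.9.2 of route/T5-N2-route-3.md («completions») at the finite places — THE CLOSING FILE of the
finite-place identification on Mathlib's `IsCMField K` (`K⁺ = maximalRealSubfield K`, datum `θ = y²`, `c y ≠ y`):
files 124 (fundamental identity, «θ a v-adic square ⟹ two primes») and 125 («e = f = 1 ⟹ L_w = Kᵥ») combine into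
* **`ncard_primesOver_eq_two_iff_isSquare`**: `v` has two primes above it in `K` ⟺ `θ` is a `v`-adic square, and
  `ncard_primesOver_eq_one_iff_not_isSquare`; `finrank_eq_one_iff_ncard_primesOver_eq_two`;
* **`ramificationIdx_mul_inertiaDeg_eq_finrank`**: `e(w∣v) · f(w∣v) = [K_w : K⁺_v]` at EVERY finite place `v` of
  `K⁺` and every `w ∣ v` — the local-degree formula, unconditionally;
* **`ncard_primesOver_mul_finrank_eq_two`**: `#{w ∣ v} · [K_w : K⁺_v] = 2 = [K : K⁺]` — the global count
  `Σ_{w ∣ v} [K_w : K⁺_v] = [K : K⁺]` of §N2.9.2's identification `K ⊗_{K⁺} K⁺_v ≅ ∏_{w ∣ v} K_w`, in kernel.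
Row N2.2.5's dictionary «v non-split in K ⟺ c ∈ D_w ⟺ …» now has its local end «⟺ [K_w : K⁺_v] = 2 ⟺ θ ∉ (K⁺_v)^{×2}»
as theorems. Mathlib + files 120–125 only. No display; no device.
§8(d): uses an L-value-free non-vanishing device: NO.
-/

namespace Summit.Ventures.HodgeRepro2.T5FinitePlaceSplitIff

open IsDedekindDomain IsDedekindDomain.HeightOneSpectrum NumberField NumberField.IsCMField Module
open scoped Summit.Ventures.HodgeRepro2.T5FinitePlaceLiesOver
open Summit.Ventures.HodgeRepro2.T5FinitePlaceCM Summit.Ventures.HodgeRepro2.T5FinitePlaceCMDecomp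
  Summit.Ventures.HodgeRepro2.T5FinitePlaceLocalDegree Summit.Ventures.HodgeRepro2.T5FinitePlaceUnramifiedResidue

variable (K : Type*) [Field K] [NumberField K] [IsCMField K]
variable (v : HeightOneSpectrum (𝓞 (maximalRealSubfield K))) (w : HeightOneSpectrum (𝓞 K))
  [w.asIdeal.LiesOver v.asIdeal]

/-- `#{w ∣ v} ∈ {1, 2}`. -/
theorem ncard_primesOver_eq_one_or_two :
    (v.asIdeal.primesOver (𝓞 K)).ncard = 1 ∨ (v.asIdeal.primesOver (𝓞 K)).ncard = 2 := by
  have h := ncard_primesOver_mul_eq_two K v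
  exact (Nat.dvd_prime Nat.prime_two).mp ⟨_, h.symm⟩

/-- Two primes above `v` ⟹ `e(w∣v) = 1`. -/
theorem ramificationIdx_eq_one_of_ncard_primesOver_eq_two (h2 : (v.asIdeal.primesOver (𝓞 K)).ncard = 2) :
    w.asIdeal.ramificationIdx (𝓞 (maximalRealSubfield K)) = 1 := by
  have h := ncard_primesOver_mul_eq_two K v
  rw [h2, Ideal.ramificationIdxIn_eq_ramificationIdx v.asIdeal w.asIdeal (K ≃ₐ[maximalRealSubfield K] K),
    Ideal.inertiaDegIn_eq_inertiaDeg v.asIdeal w.asIdeal (K ≃ₐ[maximalRealSubfield K] K)] at h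
  exact Nat.eq_one_of_mul_eq_one_right (Nat.eq_of_mul_eq_mul_left two_pos (h.trans (mul_one 2).symm))

/-- Two primes above `v` ⟹ `f(w∣v) = 1`. -/
theorem inertiaDeg_eq_one_of_ncard_primesOver_eq_two (h2 : (v.asIdeal.primesOver (𝓞 K)).ncard = 2) :
    w.asIdeal.inertiaDeg (𝓞 (maximalRealSubfield K)) = 1 := by
  have h := ncard_primesOver_mul_eq_two K v
  rw [h2, Ideal.ramificationIdxIn_eq_ramificationIdx v.asIdeal w.asIdeal (K ≃ₐ[maximalRealSubfield K] K),
    Ideal.inertiaDegIn_eq_inertiaDeg v.asIdeal w.asIdeal (K ≃ₐ[maximalRealSubfield K] K)] at h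
  exact Nat.eq_one_of_mul_eq_one_left (Nat.eq_of_mul_eq_mul_left two_pos (h.trans (mul_one 2).symm))

/-- **Two primes above `v` ⟹ `K_w = K⁺_v`** (file 125). -/
theorem finrank_eq_one_of_ncard_primesOver_eq_two (h2 : (v.asIdeal.primesOver (𝓞 K)).ncard = 2) :
    finrank (v.adicCompletion (maximalRealSubfield K)) (w.adicCompletion K) = 1 :=
  finrank_eq_one_of_ramificationIdx_eq_one_of_inertiaDeg_eq_one v w
    (ramificationIdx_eq_one_of_ncard_primesOver_eq_two K v w h2)
    (inertiaDeg_eq_one_of_ncard_primesOver_eq_two K v w h2)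

variable {θ : maximalRealSubfield K} {y : K}
variable (hθ : algebraMap (maximalRealSubfield K) K θ = y ^ 2) (hy : complexConj K y ≠ y)

include hθ hy w in
/-- **Two primes above `v` ⟹ `θ` is a `v`-adic square** (`w` is any prime above `v`). -/
theorem isSquare_of_ncard_primesOver_eq_two (h2 : (v.asIdeal.primesOver (𝓞 K)).ncard = 2) :
    IsSquare (algebraMap (maximalRealSubfield K) (v.adicCompletion (maximalRealSubfield K)) θ) :=
  (T5FinitePlaceCM.finrank_eq_one_iff_isSquare K hθ hy v w).mp (finrank_eq_one_of_ncard_primesOver_eq_two K v w h2)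

include hθ hy w in
/-- **`v` SPLITS in `K` ⟺ `θ` is a `v`-adic square** (`w` is any prime above `v`). -/
theorem ncard_primesOver_eq_two_iff_isSquare :
    (v.asIdeal.primesOver (𝓞 K)).ncard = 2 ↔
      IsSquare (algebraMap (maximalRealSubfield K) (v.adicCompletion (maximalRealSubfield K)) θ) :=
  ⟨isSquare_of_ncard_primesOver_eq_two K v w hθ hy, ncard_primesOver_eq_two_of_isSquare K v w hθ hy⟩

include hθ hy w in
/-- **`v` is NON-SPLIT in `K` ⟺ `θ` is not a `v`-adic square.** -/
theorem ncard_primesOver_eq_one_iff_not_isSquare :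
    (v.asIdeal.primesOver (𝓞 K)).ncard = 1 ↔
      ¬ IsSquare (algebraMap (maximalRealSubfield K) (v.adicCompletion (maximalRealSubfield K)) θ) := by
  rw [← ncard_primesOver_eq_two_iff_isSquare K v w hθ hy]
  rcases ncard_primesOver_eq_one_or_two K v with h | h <;> rw [h] <;> omega

include hθ hy in
/-- **`K_w = K⁺_v` ⟺ `v` splits.** -/
theorem finrank_eq_one_iff_ncard_primesOver_eq_two :
    finrank (v.adicCompletion (maximalRealSubfield K)) (w.adicCompletion K) = 1 ↔
      (v.asIdeal.primesOver (𝓞 K)).ncard = 2 := by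
  rw [T5FinitePlaceCM.finrank_eq_one_iff_isSquare K hθ hy v w, ncard_primesOver_eq_two_iff_isSquare K v w hθ hy]

include hθ hy in
/-- **`[K_w : K⁺_v] = 2` ⟺ `v` is non-split.** -/
theorem finrank_eq_two_iff_ncard_primesOver_eq_one :
    finrank (v.adicCompletion (maximalRealSubfield K)) (w.adicCompletion K) = 2 ↔
      (v.asIdeal.primesOver (𝓞 K)).ncard = 1 := by
  rw [T5FinitePlaceCM.finrank_eq_two_iff_not_isSquare K hθ hy v w,
    ncard_primesOver_eq_one_iff_not_isSquare K v w hθ hy]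

include hθ hy in
/-- **THE LOCAL-DEGREE FORMULA at every finite place:** `e(w∣v) · f(w∣v) = [K_w : K⁺_v]`. -/
theorem ramificationIdx_mul_inertiaDeg_eq_finrank :
    w.asIdeal.ramificationIdx (𝓞 (maximalRealSubfield K)) * w.asIdeal.inertiaDeg (𝓞 (maximalRealSubfield K)) =
      finrank (v.adicCompletion (maximalRealSubfield K)) (w.adicCompletion K) := by
  rcases ncard_primesOver_eq_one_or_two K v with h | h
  · exact T5FinitePlaceLocalDegree.ramificationIdx_mul_inertiaDeg_eq_finrank K v w hθ hy h
  · exact ramificationIdx_mul_inertiaDeg_eq_finrank_of_isSquare K v w hθ hy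
      (isSquare_of_ncard_primesOver_eq_two K v w hθ hy h)

include hθ hy in
/-- **THE GLOBAL COUNT:** `#{w ∣ v} · [K_w : K⁺_v] = 2 = [K : K⁺]` (every `w ∣ v` has the same local degree). -/
theorem ncard_primesOver_mul_finrank_eq_two :
    (v.asIdeal.primesOver (𝓞 K)).ncard *
      finrank (v.adicCompletion (maximalRealSubfield K)) (w.adicCompletion K) = 2 := by
  rcases ncard_primesOver_eq_one_or_two K v with h | h
  · rw [h, one_mul]
    exact finrank_eq_two_of_ncard_primesOver_eq_one K hθ hy v w h
  · rw [h, finrank_eq_one_of_ncard_primesOver_eq_two K v w h]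

include hθ hy in
/-- `#{w ∣ v} · [K_w : K⁺_v] = [K : K⁺]`. -/
theorem ncard_primesOver_mul_finrank_eq_finrank :
    (v.asIdeal.primesOver (𝓞 K)).ncard *
      finrank (v.adicCompletion (maximalRealSubfield K)) (w.adicCompletion K) =
        finrank (maximalRealSubfield K) K := by
  rw [ncard_primesOver_mul_finrank_eq_two K v w hθ hy, Algebra.IsQuadraticExtension.finrank_eq_two]

end Summit.Ventures.HodgeRepro2.T5FinitePlaceSplitIff
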